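import Literature.MathematicalPhysics.QuantumLattice.GrassmannEffectiveActionGradedTruncationPrescribedDB
import HarnessLib

/-!
# The SPECIES-GRADED cumulant bound with PRESCRIBED output legs: one species-and-degree assignment of the replicas, and any CLASS of
# species patterns, on the leg constraint (determinant-bounded covariances)

Topic `MathematicalPhysics/QuantumLattice`; the label-restricted twin of `GrassmannCumulantSpeciesGradedDB` (species-graded expansion of
`𝓔ᵀ_C(Σ_s V_s; n)`, plain pinned norms), obtained from the prescribed-legs kernel-vertex bound
`GrassmannLaplacianTruncatedBoundPrescribed.sum_norm_kernel_ursellOf_kernelVertex_le_prescribed` — stated for ARBITRARY per-copy kernels and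
per-copy two-parameter profiles `N_u(F)` — exactly as `GrassmannEffectiveActionGradedTruncationPrescribedDB` obtains the one-species graded bound:
the per-assignment majorisation `prescribedBound_le_indicator_sum` treats the landing-profile products `Π_a N(δ_a, |φ⁻¹ a|)` as an opaque nonnegative
function of the profile `φ`, so it holds verbatim with SLOT-DEPENDENT profiles (species `η_a` at slot `a`).  Benfatto–Giuliani–Mastropietro 2006,
(2.13)–(2.14), (2.77)–(2.80) with the sectorised bookkeeping of §2.4, Lemma 2.6; Gawȩdzki–Kupiainen 1985, §3:

* `prescribedBound_mul_sum_le_of_nonneg` — the per-assignment majorisation with an ARBITRARY nonnegative profile function `X(φ)` in place of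
  `Π_a N(δ_a, |φ⁻¹ a|)`: `… ≤ κ^{-r}κ^{-2(n−1)}(n−1)!α^{n−1}eⁿ · (e³κ)^{N_δ} · Σ_φ w_φ X(φ)` (`w_φ = ∏_{j∈J} 2δ_{φ j}/N_δ^{|J|}`);
* **`sum_filter_norm_kernel_speciesReplica_le_prescribed`** — ONE species-and-degree assignment `η`, on the leg constraint, one output label pinned
  at a label of copy `b` and the slots `j ∈ J` constrained:
  `≤ κ^{-r}κ^{-2(n−1)}(n−1)!α^{n−1}eⁿ · Σ_φ w_φ Π_a (e³κ)^{2δ_a} N_{η_a}(δ_a, |φ⁻¹ a|)`; `sum_filter_norm_kernel_collapse_speciesReplica_le_prescribed`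
  — collapsed, with the factor `n`, as an `if` on the constraint (`0` off it);
* **`sum_norm_kernel_speciesClass_le_graded_prescribed_of_gramBounded`** — for any finite class `𝒞` of species patterns:
  `Σ_{W : W_i = w, A_j(W_j)} ‖Σ_{η : (σ_η) ∈ 𝒞} kernel_r (collapse 𝓔ᵀ_{C'}(M_η))(W)‖ ≤
     n!·κ^{-r}κ^{-2(n−1)}α^{n−1}eⁿ · Σ_{δ : constraint} Σ_{σ ∈ 𝒞} Σ_φ w_φ Π_a (e³κ)^{2δ_a} N_{σ_a}(δ_a, |φ⁻¹ a|)`;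
* **`sum_norm_kernel_oneMarked_le_graded_prescribed_of_gramBounded`** — the class «species `t` at exactly one slot, `s₀` elsewhere» spelled out:
  pattern sum `Σ_a (e³κ)^{2δ_a} N_t(δ_a, |φ⁻¹ a|) · Π_{b≠a} (e³κ)^{2δ_b} N_{s₀}(δ_b, |φ⁻¹ b|)` inside the profile average.

The replica layer of a source-graded single-scale step on the LEVELS (prescribed-legs) track and of the prescribed-legs Lipschitz step
(`GrassmannCumulantPolarisedGradedPrescribedDB`); cell gate-hubbard-kl, K3 children stmt-…-20437 stub (e) rows C1/C2 and stmt-…-20440 token #24.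
Everything is proved; no definition, no named fact.

## Sources

G. Benfatto, A. Giuliani, V. Mastropietro, Ann. Henri Poincaré 7 (2006) 809–898, (2.13)–(2.14), (2.31), (2.66), (2.77)–(2.80), §2.4 Lemma 2.6
[`BenfattoGiulianiMastropietro2006`]; K. Gawȩdzki, A. Kupiainen, Comm. Math. Phys. 102 (1985) 1–30, §3 [`GawedzkiKupiainen1985GrossNeveu`].
-/

noncomputable section

namespace Literature.MathematicalPhysics.QuantumLattice

open GrassmannAlgebra Finset Literature.Probability.LatticeModels
open scoped InnerProductSpace Nat

universe u

/-! ### Collapse and replicas with constrained slots -/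

section Helpers

variable {𝕜 : Type*} [RCLike 𝕜] {Γ : Type u} [Fintype Γ] [DecidableEq Γ] {n : ℕ}

/-- The constrained pinned sums of the kernels of a collapsed element:
`Σ_{X : X_i = w, A_j(X_j)} ‖kernel (collapse snd F) m X‖ ≤ Σ_b Σ_{X' : X'_i = (b, w), A_j((X'_j).2)} ‖kernel F m X'‖`. [folklore] -/
private theorem sum_filter_norm_kernel_collapse_le_prescribed (F : GrassmannAlgebra 𝕜 (Fin n × Γ)) {m : ℕ} (i : Fin m) (w : Γ)
    (J : Finset (Fin m)) (A : Fin m → Γ → Bool) :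
    ∑ X ∈ univ.filter (fun X : Fin m → Γ => X i = w ∧ ∀ j ∈ J, A j (X j) = true),
        ‖kernel 𝕜 (collapse 𝕜 (Prod.snd : Fin n × Γ → Γ) F) m X‖ ≤
      ∑ b : Fin n, ∑ X' ∈ univ.filter (fun X' : Fin m → Fin n × Γ => X' i = (b, w) ∧ ∀ j ∈ J, A j (X' j).2 = true),
        ‖kernel 𝕜 F m X'‖ := by
  calc ∑ X ∈ univ.filter (fun X : Fin m → Γ => X i = w ∧ ∀ j ∈ J, A j (X j) = true),
          ‖kernel 𝕜 (collapse 𝕜 (Prod.snd : Fin n × Γ → Γ) F) m X‖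
      ≤ ∑ X ∈ univ.filter (fun X : Fin m → Γ => X i = w ∧ ∀ j ∈ J, A j (X j) = true),
          ∑ X' ∈ univ.filter (fun X' : Fin m → Fin n × Γ => ∀ j, (X' j).2 = X j), ‖kernel 𝕜 F m X'‖ := by
        refine sum_le_sum fun X _ => ?_
        rw [kernel_collapse]
        exact norm_sum_le _ _
    _ = ∑ X ∈ univ.filter (fun X : Fin m → Γ => X i = w ∧ ∀ j ∈ J, A j (X j) = true),
          ∑ X' ∈ (univ.filter fun X' : Fin m → Fin n × Γ => (X' i).2 = w ∧ ∀ j ∈ J, A j (X' j).2 = true).filter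
            (fun X' => (fun j => (X' j).2) = X), ‖kernel 𝕜 F m X'‖ := by
        refine sum_congr rfl fun X hX => sum_congr ?_ fun _ _ => rfl
        ext X'
        simp only [mem_filter, mem_univ, true_and, funext_iff]
        constructor
        · intro h
          obtain ⟨hXi, hXJ⟩ := (mem_filter.1 hX).2
          exact ⟨⟨by rw [h i]; exact hXi, fun j hj => by rw [h j]; exact hXJ j hj⟩, h⟩
        · exact fun h => h.2
    _ = ∑ X' ∈ univ.filter (fun X' : Fin m → Fin n × Γ => (X' i).2 = w ∧ ∀ j ∈ J, A j (X' j).2 = true), ‖kernel 𝕜 F m X'‖ := by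
        refine sum_fiberwise_of_maps_to (fun X' hX' => ?_) _
        rw [mem_filter] at hX' ⊢
        exact ⟨mem_univ _, hX'.2.1, hX'.2.2⟩
    _ = ∑ b : Fin n, ∑ X' ∈ (univ.filter fun X' : Fin m → Fin n × Γ => (X' i).2 = w ∧ ∀ j ∈ J, A j (X' j).2 = true).filter
          (fun X' => (X' i).1 = b), ‖kernel 𝕜 F m X'‖ :=
        (sum_fiberwise _ (fun X' : Fin m → Fin n × Γ => (X' i).1) _).symm
    _ = ∑ b : Fin n, ∑ X' ∈ univ.filter (fun X' : Fin m → Fin n × Γ => X' i = (b, w) ∧ ∀ j ∈ J, A j (X' j).2 = true),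
          ‖kernel 𝕜 F m X'‖ := by
        refine sum_congr rfl fun b _ => sum_congr ?_ fun _ _ => rfl
        ext X'
        simp only [mem_filter, mem_univ, true_and, Prod.ext_iff]
        tauto

/-- The constrained anchored sums of a replica kernel are those of the kernel (zero in the other copies). [folklore] -/
private theorem sum_filter_norm_replicaKer_le_prescribed {m : ℕ} (K : (Fin m → Γ) → 𝕜) (a : Fin n) {r : ℕ}
    (A : Fin r → Γ → Bool) (T : Finset (Fin r)) (ι : T → Fin m) (t : Fin m) {N : ℝ}
    (hN : ∀ w : Γ, ∑ Y ∈ univ.filter (fun Y : Fin m → Γ => Y t = w),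
      ‖K Y‖ * ∏ j : T, (if A j (Y (ι j)) = true then (1 : ℝ) else 0) ≤ N)
    (bw : Fin n × Γ) :
    ∑ Y' ∈ univ.filter (fun Y' : Fin m → Fin n × Γ => Y' t = bw),
        ‖replicaKer 𝕜 K a Y'‖ * ∏ j : T, (if A j (Y' (ι j)).2 = true then (1 : ℝ) else 0) ≤ N := by
  have hzero : ∀ Y' : Fin m → Fin n × Γ, Y' ∉ univ.map (copyEmb a) → ‖replicaKer 𝕜 K a Y'‖ = 0 := by
    intro Y' hY'
    rw [← filter_forall_fst_eq, mem_filter, not_and] at hY'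
    rw [replicaKer, if_neg (hY' (mem_univ _)), norm_zero]
  calc ∑ Y' ∈ univ.filter (fun Y' : Fin m → Fin n × Γ => Y' t = bw),
          ‖replicaKer 𝕜 K a Y'‖ * ∏ j : T, (if A j (Y' (ι j)).2 = true then (1 : ℝ) else 0)
      = ∑ Y' ∈ (univ.map (copyEmb (m := m) a)).filter (fun Y' => Y' t = bw),
          ‖replicaKer 𝕜 K a Y'‖ * ∏ j : T, (if A j (Y' (ι j)).2 = true then (1 : ℝ) else 0) := by
        symm
        refine sum_subset (filter_subset_filter _ (subset_univ _)) fun Y' hY' hY'2 => ?_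
        rw [hzero Y' fun hmem => hY'2 (mem_filter.2 ⟨hmem, (mem_filter.1 hY').2⟩), zero_mul]
    _ = ∑ Y ∈ univ.filter (fun Y : Fin m → Γ => copyEmb (n := n) a Y t = bw),
          ‖K Y‖ * ∏ j : T, (if A j (Y (ι j)) = true then (1 : ℝ) else 0) := by
        rw [filter_map, sum_map]
        exact sum_congr rfl fun Y _ => by rw [replicaKer_copyEmb]; rfl
    _ ≤ ∑ Y ∈ univ.filter (fun Y : Fin m → Γ => Y t = bw.2),
          ‖K Y‖ * ∏ j : T, (if A j (Y (ι j)) = true then (1 : ℝ) else 0) := by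
        refine sum_le_sum_of_subset_of_nonneg (fun Y hY => ?_) fun Y _ _ => mul_nonneg (norm_nonneg _)
          (prod_nonneg fun j _ => by split_ifs <;> norm_num)
        rw [mem_filter] at hY ⊢
        exact ⟨mem_univ _, by rw [← hY.2]; rfl⟩
    _ ≤ N := hN bw.2

end Helpers

/-! ### The per-assignment majorisation with an arbitrary nonnegative profile function -/

section Majorisation

variable {n : ℕ}

/-- **The per-assignment majorisation of the prescribed cumulant bound on the leg constraint, for an ARBITRARY nonnegative profile function**
(`prescribedBound_le_indicator_sum` with `Π_a N(δ_a, |φ⁻¹ a|)` replaced by any `X(φ) ≥ 0`): for `r + 2(n−1) ≤ N_δ = Σ_a 2δ_a` and `λ_δ = 1/(α(N_δ + n))`,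
with the free count `∏_{j∉J}(N_δ − j) ≤ N_δ^{r−|J|}`, the multiplicity `∏_{j∈J} 2δ_{φ j} = N_δ^{|J|}·w_φ` and `N_δ^r/r! ≤ e^{N_δ}`,
`(r!)⁻¹(∏_{j∉J}(N_δ−j)) κ^{N_δ−r−2(n−1)} (Σ_φ (∏_j 2δ_{φ j}) X(φ)) · λ_δ^{-(n−1)} ∏_ℓ (1 + λ_δ α (pair degrees)) ≤
   κ^{-r} κ^{-2(n−1)} (n−1)! α^{n−1} eⁿ · (e³κ)^{N_δ} · Σ_φ w_φ X(φ)`. [cite: BenfattoGiulianiMastropietro2006, (2.77)-(2.80) and Lemma 2.6] -/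
theorem prescribedBound_mul_sum_le_of_nonneg {κ α : ℝ} (hκ : 0 < κ) (hα : 0 < α) (hn : 0 < n) (r : ℕ) (J : Finset (Fin r))
    (δ : Fin n → ℕ) (hle : r + 2 * (n - 1) ≤ ∑ a, 2 * δ a) (X : (J → Fin n) → ℝ) (hX0 : ∀ pf, 0 ≤ X pf) :
    ((((r.factorial : ℝ))⁻¹ * ((∏ j ∈ univ.filter (fun j : Fin r => j ∉ J), ((∑ a, 2 * δ a) - (j : ℕ)) : ℕ) : ℝ)) *
          κ ^ ((∑ a, 2 * δ a) - (r + 2 * (n - 1))) *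
          ∑ pf : J → Fin n, (∏ j, ((2 * δ (pf j) : ℕ) : ℝ)) * X pf) *
        (((α * ((∑ a, (2 * δ a : ℝ)) + n))⁻¹)⁻¹ ^ (n - 1) *
          ∏ ℓ : Sym2 (Fin n), (1 + (α * ((∑ a, (2 * δ a : ℝ)) + n))⁻¹ * (α * (pairDeg (fun a => 2 * δ a) ℓ : ℝ)))) ≤
      (κ⁻¹ ^ r * κ⁻¹ ^ (2 * (n - 1)) * (((n - 1)! : ℝ) * α ^ (n - 1) * Real.exp n)) *
        ((Real.exp 3 * κ) ^ (∑ a, 2 * δ a) *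
          ∑ pf : J → Fin n, ((∏ j, ((2 * δ (pf j) : ℕ) : ℝ)) / ((∑ a, 2 * δ a : ℕ) : ℝ) ^ J.card) * X pf) := by
  -- abbreviations
  set Nδ : ℕ := ∑ a, 2 * δ a with hNδ
  set ext : ℕ := ∏ j ∈ univ.filter (fun j : Fin r => j ∉ J), (Nδ - (j : ℕ)) with hext
  set M : (J → Fin n) → ℝ := fun pf => ∏ j, ((2 * δ (pf j) : ℕ) : ℝ) with hM
  set wt : (J → Fin n) → ℝ := fun pf => M pf / (Nδ : ℝ) ^ J.card with hwt
  set tree : ℝ := ((α * ((∑ a, (2 * δ a : ℝ)) + n))⁻¹)⁻¹ ^ (n - 1) *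
    ∏ ℓ : Sym2 (Fin n), (1 + (α * ((∑ a, (2 * δ a : ℝ)) + n))⁻¹ * (α * (pairDeg (fun a => 2 * δ a) ℓ : ℝ))) with htree
  have hr : r ≤ Nδ := by omega
  have hJ : J.card ≤ r := by simpa using J.card_le_univ
  have hM0 : ∀ pf, 0 ≤ M pf := fun pf => prod_nonneg fun j _ => Nat.cast_nonneg _
  have hwt0 : ∀ pf, 0 ≤ wt pf := fun pf => div_nonneg (hM0 pf) (pow_nonneg (Nat.cast_nonneg _) _)
  -- the power of `Nδ` carried by the weights is never a harmful zero
  have hpow : ((Nδ : ℝ)) ^ J.card ≠ 0 := by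
    by_cases hJ0 : J.card = 0
    · rw [hJ0, pow_zero]; exact one_ne_zero
    · have : 0 < r := lt_of_lt_of_le (Nat.pos_of_ne_zero hJ0) hJ
      exact pow_ne_zero _ (by exact_mod_cast (by omega : Nδ ≠ 0))
  have hMw : ∀ pf, M pf = (Nδ : ℝ) ^ J.card * wt pf := fun pf => by
    rw [hwt]
    dsimp only
    rw [mul_div_cancel₀ _ hpow]
  -- the free count and the falling factorial: `(r!)⁻¹ ext Nδ^{|J|} ≤ Nδ^r / r! ≤ e^{Nδ}`
  have hext_le : (ext : ℝ) ≤ (Nδ : ℝ) ^ (r - J.card) := by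
    have h1 : ext ≤ Nδ ^ (univ.filter (fun j : Fin r => j ∉ J)).card :=
      prod_le_pow_card _ _ _ fun j _ => Nat.sub_le _ _
    have h2 : (univ.filter (fun j : Fin r => j ∉ J)).card = r - J.card := by
      rw [filter_not, filter_mem_eq_inter, univ_inter, card_univ_sdiff, Fintype.card_fin]
    rw [h2] at h1
    exact_mod_cast h1
  have hcount : ((r.factorial : ℝ))⁻¹ * (ext : ℝ) * (Nδ : ℝ) ^ J.card ≤ Real.exp Nδ := by
    have h1 : ((r.factorial : ℝ))⁻¹ * (ext : ℝ) * (Nδ : ℝ) ^ J.card ≤ ((r.factorial : ℝ))⁻¹ * (Nδ : ℝ) ^ r := by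
      rw [mul_assoc]
      refine mul_le_mul_of_nonneg_left ?_ (inv_nonneg.2 (Nat.cast_nonneg _))
      calc (ext : ℝ) * (Nδ : ℝ) ^ J.card ≤ (Nδ : ℝ) ^ (r - J.card) * (Nδ : ℝ) ^ J.card :=
            mul_le_mul_of_nonneg_right hext_le (pow_nonneg (Nat.cast_nonneg _) _)
        _ = (Nδ : ℝ) ^ r := by rw [← pow_add, Nat.sub_add_cancel hJ]
    have h2 : ((r.factorial : ℝ))⁻¹ * (Nδ : ℝ) ^ r ≤ Real.exp Nδ := by
      rw [inv_mul_eq_div]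
      exact Real.pow_div_factorial_le_exp _ (Nat.cast_nonneg _) r
    exact h1.trans h2
  -- the powers of `κ`
  have hκpow : κ ^ (Nδ - (r + 2 * (n - 1))) = κ ^ Nδ * (κ⁻¹ ^ r * κ⁻¹ ^ (2 * (n - 1))) := by
    rw [pow_sub₀ κ hκ.ne' hle, ← inv_pow, pow_add]
  -- the tree factor
  have hT := treeFactor_choice_le hn δ hα
  have hTnonneg : 0 ≤ tree := by
    have hs : 0 ≤ ∑ a, (2 * δ a : ℝ) := sum_nonneg fun a _ => by positivity
    exact mul_nonneg (by positivity) (prod_nonneg fun ℓ _ => by positivity)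
  have hNδcast : (∑ a, (2 * δ a : ℝ)) = (Nδ : ℝ) := by rw [hNδ]; push_cast; rfl
  -- assemble
  have hSw0 : 0 ≤ ∑ pf, wt pf * X pf := sum_nonneg fun pf _ => mul_nonneg (hwt0 pf) (hX0 pf)
  calc ((((r.factorial : ℝ))⁻¹ * (ext : ℝ)) * κ ^ (Nδ - (r + 2 * (n - 1))) * ∑ pf, M pf * X pf) * tree
      = ((((r.factorial : ℝ))⁻¹ * (ext : ℝ) * (Nδ : ℝ) ^ J.card) * (κ ^ Nδ * (κ⁻¹ ^ r * κ⁻¹ ^ (2 * (n - 1)))) *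
          ∑ pf, wt pf * X pf) * tree := by
        rw [hκpow]
        simp only [hMw]
        rw [show ∑ pf : J → Fin n, (Nδ : ℝ) ^ J.card * wt pf * X pf = (Nδ : ℝ) ^ J.card * ∑ pf, wt pf * X pf by
          rw [mul_sum]; exact sum_congr rfl fun pf _ => by ring]
        ring
    _ ≤ (Real.exp Nδ * (κ ^ Nδ * (κ⁻¹ ^ r * κ⁻¹ ^ (2 * (n - 1)))) * ∑ pf, wt pf * X pf) *
          (((n - 1)! : ℝ) * α ^ (n - 1) * Real.exp (2 * (∑ a, (2 * δ a : ℝ)) + n)) := by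
        refine mul_le_mul (mul_le_mul_of_nonneg_right (mul_le_mul_of_nonneg_right hcount (by positivity)) hSw0) hT hTnonneg ?_
        exact mul_nonneg (mul_nonneg (by positivity) (by positivity)) hSw0
    _ = (κ⁻¹ ^ r * κ⁻¹ ^ (2 * (n - 1)) * (((n - 1)! : ℝ) * α ^ (n - 1) * Real.exp n)) *
          ((Real.exp 3 * κ) ^ Nδ * ∑ pf, wt pf * X pf) := by
        rw [hNδcast]
        have hexp : Real.exp (2 * (Nδ : ℝ) + n) = Real.exp n * Real.exp 2 ^ Nδ := by
          rw [Real.exp_add, mul_comm, ← Real.exp_nat_mul, mul_comm (2 : ℝ) (Nδ : ℝ)]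
        have hexp1 : Real.exp (Nδ : ℝ) = Real.exp 1 ^ Nδ := by rw [← Real.exp_nat_mul, mul_one]
        have hexp3 : Real.exp 3 = Real.exp 1 * Real.exp 2 := by rw [← Real.exp_add]; norm_num
        rw [hexp, hexp1, hexp3, mul_pow, mul_pow]
        ring

end Majorisation

/-! ### One assignment, prescribed legs -/

section Species

variable {𝕜 : Type*} [RCLike 𝕜] {Γ : Type u} [Fintype Γ] [DecidableEq Γ] {n : ℕ} (C : Matrix Γ Γ 𝕜)
variable {S : Type*} [Fintype S] [DecidableEq S]

omit [Fintype S] [DecidableEq S] in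
/-- **One species-and-degree assignment with prescribed output legs, on the leg constraint** (BGM 2006 (2.77)–(2.80) with Lemma 2.6, for per-copy
kernels): kernels `K_s(m',·)` with anchored `L¹` norms with `F` further legs constrained to the prescribed predicates `≤ N_s(m', F)`, a
replica-Gram-bounded covariance (constant `κ`), one-copy row and column sums `≤ α`; if `r + 2(n−1) ≤ Σ_a 2δ_a` then for every copy `b`, one output
label pinned at a label of copy `b` and the slots `j ∈ J` constrained,
`Σ_{W'} ‖kernel_r 𝓔ᵀ_{C'}(M_η)(W')‖ ≤ κ^{-r}κ^{-2(n−1)}(n−1)!α^{n−1}eⁿ · Σ_φ w_φ Π_a (e³κ)^{2δ_a} N_{η_a}(δ_a, |φ⁻¹ a|)`.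
[cite: BenfattoGiulianiMastropietro2006, (2.77)-(2.80) and Lemma 2.6] -/
theorem sum_filter_norm_kernel_speciesReplica_le_prescribed {κ : ℝ} (hκ : 0 < κ) (hGB : IsGramBoundedR C κ)
    (Ksp : S → (m' : ℕ) → (Fin (2 * m') → Γ) → 𝕜) {r : ℕ} (J : Finset (Fin r)) (A : Fin r → Γ → Bool)
    (Nsp : S → ℕ → ℕ → ℝ) (hN0 : ∀ s m' F, 0 ≤ Nsp s m' F)
    (hN : ∀ (s : S) (m' : ℕ) (T : Finset (Fin r)), T ⊆ J → ∀ (ι : T → Fin (2 * m')), Function.Injective ι →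
      ∀ (t : Fin (2 * m')), (∀ j, ι j ≠ t) → ∀ a : Γ,
        ∑ Y ∈ univ.filter (fun Y : Fin (2 * m') → Γ => Y t = a),
          ‖Ksp s m' Y‖ * ∏ j : T, (if A j (Y (ι j)) = true then (1 : ℝ) else 0) ≤ Nsp s m' T.card)
    {α : ℝ} (hα : 0 < α) (hrow : ∀ X, ∑ Y, ‖C X Y‖ ≤ α) (hcol : ∀ Y, ∑ X, ‖C X Y‖ ≤ α)
    (hn : 0 < n) (i : Fin r) (hi : i ∉ J) (w : Γ) (η : Fin n → S × ℕ) (hle : r + 2 * (n - 1) ≤ ∑ a, 2 * (η a).2) (b : Fin n) :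
    ∑ W' ∈ univ.filter (fun W' : Fin r → Fin n × Γ => W' i = (b, w) ∧ ∀ j ∈ J, A j (W' j).2 = true),
        ‖kernel 𝕜 ((ursellOf (convMoment 𝕜 (C.submatrix Prod.snd Prod.snd)
            (kernelVertex 𝕜 (deg := fun b : Fin n => 2 * (η b).2) (fun b => even_two_mul (η b).2)
              fun b => replicaKer 𝕜 (Ksp (η b).1 (η b).2) b)) univ : evenPart 𝕜 (Fin n × Γ)) : GrassmannAlgebra 𝕜 (Fin n × Γ)) r W'‖ ≤
      (κ⁻¹ ^ r * κ⁻¹ ^ (2 * (n - 1)) * (((n - 1)! : ℝ) * α ^ (n - 1) * Real.exp n)) *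
        ∑ pf : J → Fin n, ((∏ j, ((2 * (η (pf j)).2 : ℕ) : ℝ)) / ((∑ a, 2 * (η a).2 : ℕ) : ℝ) ^ J.card) *
          ∏ a, (Real.exp 3 * κ) ^ (2 * (η a).2) * Nsp (η a).1 (η a).2 (univ.filter fun j : J => pf j = a).card := by
  set C' : Matrix (Fin n × Γ) (Fin n × Γ) 𝕜 := C.submatrix Prod.snd Prod.snd with hC'
  have hGB' : IsGramBounded C' κ := by rw [hC']; exact (hGB.submatrix Prod.snd).isGramBounded
  set δ : Fin n → ℕ := fun a => (η a).2 with hδ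
  have hKs : ∀ (v : Fin n) (Yv : Fin (2 * (η v).2) → Fin n × Γ), replicaKer 𝕜 (Ksp (η v).1 (η v).2) v Yv ≠ 0 → ∀ j, (Yv j).1 = v :=
    fun v Yv h j => replicaKer_support 𝕜 (Ksp (η v).1 (η v).2) v Yv h j
  have hcore := sum_norm_kernel_ursellOf_kernelVertex_le_prescribed C' (Prod.fst : Fin n × Γ → Fin n)
    (fun b => replicaKer 𝕜 (Ksp (η b).1 (η b).2) b) hκ.le hGB' (fun b => even_two_mul (η b).2) hKs J (fun j X' => A j X'.2)
    (fun u F => Nsp (η u).1 (η u).2 F) (fun u F => hN0 _ _ _)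
    (fun u T hT ι hι t ht a' => sum_filter_norm_replicaKer_le_prescribed (Ksp (η u).1 (η u).2) u A T ι t
      (fun w' => hN (η u).1 (η u).2 T hT ι hι t ht w') a')
    hα.le (fun ℓ X' => sum_norm_typeRestrict_submatrix_le C hα.le hrow ℓ X') (fun ℓ Y' => sum_norm_typeRestrict_submatrix_le' C hα.le hcol ℓ Y')
    (lam := (α * ((∑ a, (2 * δ a : ℝ)) + n))⁻¹) (by positivity) i hi (b, w)
  refine hcore.trans ?_
  have hsumδ : (∑ v, 2 * (η v).2) = ∑ a, 2 * δ a := rfl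
  have hpd : (pairDeg (fun b : Fin n => 2 * (η b).2)) = pairDeg (fun a => 2 * δ a) := rfl
  have hdegφ : ∀ pf : J → Fin n, (∏ j, ((2 * (η (pf j)).2 : ℕ) : ℝ)) = ∏ j, ((2 * δ (pf j) : ℕ) : ℝ) := fun pf => rfl
  rw [hsumδ, hpd]
  simp only [hdegφ]
  have hX0 : ∀ pf : J → Fin n, 0 ≤ ∏ a, Nsp (η a).1 (η a).2 (univ.filter fun j : J => pf j = a).card :=
    fun pf => prod_nonneg fun a _ => hN0 _ _ _
  refine (prescribedBound_mul_sum_le_of_nonneg hκ hα hn r J δ hle _ hX0).trans (le_of_eq ?_)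
  congr 1
  rw [mul_sum]
  refine sum_congr rfl fun pf _ => ?_
  have hsplit : ∏ a, (Real.exp 3 * κ) ^ (2 * (η a).2) * Nsp (η a).1 (η a).2 (univ.filter fun j : J => pf j = a).card =
      (Real.exp 3 * κ) ^ (∑ a, 2 * δ a) * ∏ a, Nsp (η a).1 (η a).2 (univ.filter fun j : J => pf j = a).card := by
    rw [prod_mul_distrib, prod_pow_eq_pow_sum]
  rw [hsplit]
  ring

omit [Fintype S] [DecidableEq S] in
/-- Off the leg constraint every kernel of the assignment's replica cumulant vanishes (`GrassmannCumulantSpeciesGradedDB.kernel_speciesReplica_eq_zero_of_lt`;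
every tree has `n − 1` lines deleting two fields each). [cite: BenfattoGiulianiMastropietro2006, (2.66)] -/
private theorem kernel_speciesReplica_eq_zero_of_lt' {κ : ℝ} (hκ : 0 < κ) (hGB : IsGramBoundedR C κ)
    (Ksp : S → (m' : ℕ) → (Fin (2 * m') → Γ) → 𝕜) (hn : 0 < n) {r : ℕ} (η : Fin n → S × ℕ)
    (hlt : ¬ r + 2 * (n - 1) ≤ ∑ a, 2 * (η a).2) (W' : Fin r → Fin n × Γ) :
    kernel 𝕜 ((ursellOf (convMoment 𝕜 (C.submatrix Prod.snd Prod.snd)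
        (kernelVertex 𝕜 (deg := fun b : Fin n => 2 * (η b).2) (fun b => even_two_mul (η b).2)
          fun b => replicaKer 𝕜 (Ksp (η b).1 (η b).2) b)) univ : evenPart 𝕜 (Fin n × Γ)) : GrassmannAlgebra 𝕜 (Fin n × Γ)) r W' = 0 := by
  have hGB' : IsGramBounded (C.submatrix Prod.snd Prod.snd : Matrix (Fin n × Γ) (Fin n × Γ) 𝕜) κ := (hGB.submatrix Prod.snd).isGramBounded
  exact kernel_ursellOf_kernelVertex_eq_zero_of_lt_of_gramBounded (C.submatrix Prod.snd Prod.snd) (Prod.fst : Fin n × Γ → Fin n)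
    (fun b => replicaKer 𝕜 (Ksp (η b).1 (η b).2) b) hκ.le hGB' (fun b => even_two_mul (η b).2)
    (fun v Yv h j => replicaKer_support 𝕜 (Ksp (η v).1 (η v).2) v Yv h j) ⟨0, hn⟩ (not_le.1 hlt) W'

omit [Fintype S] [DecidableEq S] in
/-- **One assignment with prescribed legs, collapsed**: on the leg constraint the constrained pinned sum of the kernels of `collapse 𝓔ᵀ_{C'}(M_η)` is
at most `n·κ^{-r}κ^{-2(n−1)}(n−1)!α^{n−1}eⁿ · Σ_φ w_φ Π_a (e³κ)^{2δ_a} N_{η_a}(δ_a, |φ⁻¹ a|)`, and `0` off it.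
[cite: BenfattoGiulianiMastropietro2006, (2.77)-(2.80) and Lemma 2.6] -/
theorem sum_filter_norm_kernel_collapse_speciesReplica_le_prescribed {κ : ℝ} (hκ : 0 < κ) (hGB : IsGramBoundedR C κ)
    (Ksp : S → (m' : ℕ) → (Fin (2 * m') → Γ) → 𝕜) {r : ℕ} (J : Finset (Fin r)) (A : Fin r → Γ → Bool)
    (Nsp : S → ℕ → ℕ → ℝ) (hN0 : ∀ s m' F, 0 ≤ Nsp s m' F)
    (hN : ∀ (s : S) (m' : ℕ) (T : Finset (Fin r)), T ⊆ J → ∀ (ι : T → Fin (2 * m')), Function.Injective ι →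
      ∀ (t : Fin (2 * m')), (∀ j, ι j ≠ t) → ∀ a : Γ,
        ∑ Y ∈ univ.filter (fun Y : Fin (2 * m') → Γ => Y t = a),
          ‖Ksp s m' Y‖ * ∏ j : T, (if A j (Y (ι j)) = true then (1 : ℝ) else 0) ≤ Nsp s m' T.card)
    {α : ℝ} (hα : 0 < α) (hrow : ∀ X, ∑ Y, ‖C X Y‖ ≤ α) (hcol : ∀ Y, ∑ X, ‖C X Y‖ ≤ α)
    (hn : 0 < n) (i : Fin r) (hi : i ∉ J) (w : Γ) (η : Fin n → S × ℕ) :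
    ∑ W ∈ univ.filter (fun W : Fin r → Γ => W i = w ∧ ∀ j ∈ J, A j (W j) = true),
        ‖kernel 𝕜 (collapse 𝕜 (Prod.snd : Fin n × Γ → Γ)
          ((ursellOf (convMoment 𝕜 (C.submatrix Prod.snd Prod.snd)
              (kernelVertex 𝕜 (deg := fun b : Fin n => 2 * (η b).2) (fun b => even_two_mul (η b).2)
                fun b => replicaKer 𝕜 (Ksp (η b).1 (η b).2) b)) univ : evenPart 𝕜 (Fin n × Γ)) : GrassmannAlgebra 𝕜 (Fin n × Γ))) r W‖ ≤
      if r + 2 * (n - 1) ≤ ∑ a, 2 * (η a).2 then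
        (n : ℝ) * ((κ⁻¹ ^ r * κ⁻¹ ^ (2 * (n - 1)) * (((n - 1)! : ℝ) * α ^ (n - 1) * Real.exp n)) *
          ∑ pf : J → Fin n, ((∏ j, ((2 * (η (pf j)).2 : ℕ) : ℝ)) / ((∑ a, 2 * (η a).2 : ℕ) : ℝ) ^ J.card) *
            ∏ a, (Real.exp 3 * κ) ^ (2 * (η a).2) * Nsp (η a).1 (η a).2 (univ.filter fun j : J => pf j = a).card)
      else 0 := by
  split_ifs with hle
  · calc _ ≤ ∑ b : Fin n, ∑ W' ∈ univ.filter (fun W' : Fin r → Fin n × Γ => W' i = (b, w) ∧ ∀ j ∈ J, A j (W' j).2 = true),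
          ‖kernel 𝕜 ((ursellOf (convMoment 𝕜 (C.submatrix Prod.snd Prod.snd)
              (kernelVertex 𝕜 (deg := fun b : Fin n => 2 * (η b).2) (fun b => even_two_mul (η b).2)
                fun b => replicaKer 𝕜 (Ksp (η b).1 (η b).2) b)) univ : evenPart 𝕜 (Fin n × Γ)) : GrassmannAlgebra 𝕜 (Fin n × Γ)) r W'‖ :=
          sum_filter_norm_kernel_collapse_le_prescribed _ i w J A
      _ ≤ ∑ _b : Fin n, (κ⁻¹ ^ r * κ⁻¹ ^ (2 * (n - 1)) * (((n - 1)! : ℝ) * α ^ (n - 1) * Real.exp n)) *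
          ∑ pf : J → Fin n, ((∏ j, ((2 * (η (pf j)).2 : ℕ) : ℝ)) / ((∑ a, 2 * (η a).2 : ℕ) : ℝ) ^ J.card) *
            ∏ a, (Real.exp 3 * κ) ^ (2 * (η a).2) * Nsp (η a).1 (η a).2 (univ.filter fun j : J => pf j = a).card :=
          sum_le_sum fun b _ =>
            sum_filter_norm_kernel_speciesReplica_le_prescribed C hκ hGB Ksp J A Nsp hN0 hN hα hrow hcol hn i hi w η hle b
      _ = _ := by rw [sum_const, card_univ, Fintype.card_fin, nsmul_eq_mul]
  · refine le_of_eq (sum_eq_zero fun W _ => ?_)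
    rw [kernel_collapse, sum_eq_zero fun W' _ => kernel_speciesReplica_eq_zero_of_lt' C hκ hGB Ksp hn η hle W', norm_zero]

/-! ### A class of species patterns, prescribed legs -/

/-- **The part of `𝓔ᵀ_C(Σ_s V_s; n)` carried by a CLASS of species patterns, with prescribed output legs** (BGM 2006 (2.13)–(2.14), (2.77)–(2.80),
Lemma 2.6; the leg constraint KEPT, the graded terms averaged over the landing profiles): for any finite set `𝒞` of patterns `σ : Fin n → S`, one
output label pinned, the slots `j ∈ J` constrained and the others summed,
`Σ_W ‖Σ_{η : (σ_η) ∈ 𝒞} kernel_r (collapse 𝓔ᵀ_{C'}(M_η))(W)‖ ≤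
   n!·κ^{-r}κ^{-2(n−1)}α^{n−1}eⁿ · Σ_{δ ∈ degs^n : r + 2(n−1) ≤ Σ 2δ_a} Σ_{σ ∈ 𝒞} Σ_φ w_φ Π_a (e³κ)^{2δ_a} N_{σ_a}(δ_a, |φ⁻¹ a|)`.
[cite: BenfattoGiulianiMastropietro2006, (2.13)-(2.14), (2.77)-(2.80) and Lemma 2.6] -/
theorem sum_norm_kernel_speciesClass_le_graded_prescribed_of_gramBounded {κ : ℝ} (hκ : 0 < κ) (hGB : IsGramBoundedR C κ)
    (degs : Finset ℕ) (Ksp : S → (m' : ℕ) → (Fin (2 * m') → Γ) → 𝕜) {r : ℕ} (J : Finset (Fin r)) (A : Fin r → Γ → Bool)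
    (Nsp : S → ℕ → ℕ → ℝ) (hN0 : ∀ s m' F, 0 ≤ Nsp s m' F)
    (hN : ∀ (s : S) (m' : ℕ) (T : Finset (Fin r)), T ⊆ J → ∀ (ι : T → Fin (2 * m')), Function.Injective ι →
      ∀ (t : Fin (2 * m')), (∀ j, ι j ≠ t) → ∀ a : Γ,
        ∑ Y ∈ univ.filter (fun Y : Fin (2 * m') → Γ => Y t = a),
          ‖Ksp s m' Y‖ * ∏ j : T, (if A j (Y (ι j)) = true then (1 : ℝ) else 0) ≤ Nsp s m' T.card)
    {α : ℝ} (hα : 0 < α) (hrow : ∀ X, ∑ Y, ‖C X Y‖ ≤ α) (hcol : ∀ Y, ∑ X, ‖C X Y‖ ≤ α)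
    (hn : 0 < n) (𝒞 : Finset (Fin n → S)) (i : Fin r) (hi : i ∉ J) (w : Γ) :
    ∑ W ∈ univ.filter (fun W : Fin r → Γ => W i = w ∧ ∀ j ∈ J, A j (W j) = true),
        ‖∑ η ∈ (Fintype.piFinset (fun _ : Fin n => (univ : Finset S) ×ˢ degs)).filter (fun η => (fun b => (η b).1) ∈ 𝒞),
          kernel 𝕜 (collapse 𝕜 (Prod.snd : Fin n × Γ → Γ)
            ((ursellOf (convMoment 𝕜 (C.submatrix Prod.snd Prod.snd)
                (kernelVertex 𝕜 (deg := fun b : Fin n => 2 * (η b).2) (fun b => even_two_mul (η b).2)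
                  fun b => replicaKer 𝕜 (Ksp (η b).1 (η b).2) b)) univ : evenPart 𝕜 (Fin n × Γ)) : GrassmannAlgebra 𝕜 (Fin n × Γ))) r W‖ ≤
      (n ! : ℝ) * (κ⁻¹ ^ r * κ⁻¹ ^ (2 * (n - 1)) * (α ^ (n - 1) * Real.exp n)) *
        ∑ δ ∈ (Fintype.piFinset fun _ : Fin n => degs) with r + 2 * (n - 1) ≤ ∑ a, 2 * δ a,
          ∑ σ ∈ 𝒞, ∑ pf : J → Fin n, ((∏ j, ((2 * δ (pf j) : ℕ) : ℝ)) / ((∑ a, 2 * δ a : ℕ) : ℝ) ^ J.card) *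
            ∏ a, (Real.exp 3 * κ) ^ (2 * δ a) * Nsp (σ a) (δ a) (univ.filter fun j : J => pf j = a).card := by
  -- abbreviations
  set T : Finset (S × ℕ) := (univ : Finset S) ×ˢ degs with hT
  set Δ : Finset (Fin n → ℕ) := Fintype.piFinset (fun _ : Fin n => degs) with hΔ
  set c : ℝ := κ⁻¹ ^ r * κ⁻¹ ^ (2 * (n - 1)) * (((n - 1)! : ℝ) * α ^ (n - 1) * Real.exp n) with hc
  set G : (Fin n → S) → (Fin n → ℕ) → ℝ := fun σ δ =>
    ∑ pf : J → Fin n, ((∏ j, ((2 * δ (pf j) : ℕ) : ℝ)) / ((∑ a, 2 * δ a : ℕ) : ℝ) ^ J.card) *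
      ∏ a, (Real.exp 3 * κ) ^ (2 * δ a) * Nsp (σ a) (δ a) (univ.filter fun j : J => pf j = a).card with hG
  set U : (Fin n → S × ℕ) → GrassmannAlgebra 𝕜 (Fin n × Γ) := fun η =>
    ((ursellOf (convMoment 𝕜 (C.submatrix Prod.snd Prod.snd)
      (kernelVertex 𝕜 (deg := fun b : Fin n => 2 * (η b).2) (fun b => even_two_mul (η b).2)
        fun b => replicaKer 𝕜 (Ksp (η b).1 (η b).2) b)) univ : evenPart 𝕜 (Fin n × Γ)) : GrassmannAlgebra 𝕜 (Fin n × Γ)) with hU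
  set F : Finset (Fin n → S × ℕ) := (Fintype.piFinset (fun _ : Fin n => T)).filter (fun η => (fun b => (η b).1) ∈ 𝒞) with hF
  set Wset := univ.filter (fun W : Fin r → Γ => W i = w ∧ ∀ j ∈ J, A j (W j) = true) with hWset
  -- the bound of one assignment, as an `if` in the (pattern, degrees) variables
  set B : (Fin n → S × ℕ) → ℝ := fun η =>
    if r + 2 * (n - 1) ≤ ∑ a, 2 * (η a).2 then (n : ℝ) * (c * G (fun b => (η b).1) (fun b => (η b).2)) else 0 with hB
  have hBη : ∀ η, ∑ W ∈ Wset, ‖kernel 𝕜 (collapse 𝕜 (Prod.snd : Fin n × Γ → Γ) (U η)) r W‖ ≤ B η := by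
    intro η
    have h := sum_filter_norm_kernel_collapse_speciesReplica_le_prescribed C hκ hGB Ksp J A Nsp hN0 hN hα hrow hcol hn i hi w η
    refine h.trans (le_of_eq ?_)
    rw [hB]
  -- split an assignment into its species pattern and its degrees
  set e : (Fin n → S × ℕ) ≃ (Fin n → S) × (Fin n → ℕ) := Equiv.arrowProdEquivProdArrow (Fin n) (fun _ => S) (fun _ => ℕ) with he
  have hsplit : ∑ η ∈ F, B η = ∑ p ∈ 𝒞 ×ˢ Δ, (if r + 2 * (n - 1) ≤ ∑ a, 2 * p.2 a then (n : ℝ) * (c * G p.1 p.2) else 0) := by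
    refine sum_equiv e (fun η => ?_) (fun η _ => ?_)
    · rw [hF, mem_filter, Fintype.mem_piFinset, mem_product, hΔ, Fintype.mem_piFinset, he]
      simp only [Equiv.arrowProdEquivProdArrow_apply, hT, mem_product, mem_univ, true_and]
      tauto
    · rw [hB, he]
      simp only [Equiv.arrowProdEquivProdArrow_apply]
  -- assemble
  calc ∑ W ∈ Wset, ‖∑ η ∈ F, kernel 𝕜 (collapse 𝕜 (Prod.snd : Fin n × Γ → Γ) (U η)) r W‖
      ≤ ∑ W ∈ Wset, ∑ η ∈ F, ‖kernel 𝕜 (collapse 𝕜 (Prod.snd : Fin n × Γ → Γ) (U η)) r W‖ :=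
        sum_le_sum fun W _ => norm_sum_le _ _
    _ = ∑ η ∈ F, ∑ W ∈ Wset, ‖kernel 𝕜 (collapse 𝕜 (Prod.snd : Fin n × Γ → Γ) (U η)) r W‖ := sum_comm
    _ ≤ ∑ η ∈ F, B η := sum_le_sum fun η _ => hBη η
    _ = ∑ p ∈ 𝒞 ×ˢ Δ, (if r + 2 * (n - 1) ≤ ∑ a, 2 * p.2 a then (n : ℝ) * (c * G p.1 p.2) else 0) := hsplit
    _ = ∑ σ ∈ 𝒞, ∑ δ ∈ Δ with r + 2 * (n - 1) ≤ ∑ a, 2 * δ a, (n : ℝ) * (c * G σ δ) := by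
        rw [sum_product]
        exact sum_congr rfl fun σ _ => (sum_filter _ _).symm
    _ = (n : ℝ) * c * ∑ δ ∈ Δ with r + 2 * (n - 1) ≤ ∑ a, 2 * δ a, ∑ σ ∈ 𝒞, G σ δ := by
        rw [sum_comm, mul_sum]
        refine sum_congr rfl fun δ _ => ?_
        rw [mul_sum]
        exact sum_congr rfl fun σ _ => by ring
    _ = _ := by
        rw [hc, ← Nat.mul_factorial_pred (Nat.pos_iff_ne_zero.1 hn), Nat.cast_mul, hG]
        ring

/-! ### The one-marked-slot class spelled out, prescribed legs -/

omit [Fintype S] [DecidableEq S] in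
/-- The patterns «species `t` at exactly the slot `a`, species `s₀` elsewhere» are distinct for distinct `a` (`t ≠ s₀`). [folklore] -/
private theorem update_const_injective' {s₀ t : S} (hts : t ≠ s₀) :
    Function.Injective (fun a : Fin n => Function.update (fun _ : Fin n => s₀) a t) := by
  intro a a' h
  by_contra hne
  have h1 : Function.update (fun _ : Fin n => s₀) a t a = Function.update (fun _ : Fin n => s₀) a' t a := congrFun h a
  rw [Function.update_self, Function.update_of_ne hne] at h1
  exact hts h1

omit [Fintype S] in
/-- The one-marked-slot class spelled out, with slot-dependent profile factors: over the patterns `σ_a = (s₀,…, t at slot a, …,s₀)` (`t ≠ s₀`),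
`Σ_σ Π_b G_b(σ_b) = Σ_a G_a(t) · Π_{b ≠ a} G_b(s₀)`. [folklore] -/
private theorem sum_oneMarked_eq' {s₀ t : S} (hts : t ≠ s₀) (G : Fin n → S → ℝ) :
    ∑ σ ∈ (univ : Finset (Fin n)).image (fun a => Function.update (fun _ : Fin n => s₀) a t), ∏ b, G b (σ b) =
      ∑ a, G a t * ∏ b ∈ univ.erase a, G b s₀ := by
  rw [sum_image fun a _ a' _ h => update_const_injective' hts h]
  refine sum_congr rfl fun a _ => ?_
  rw [← mul_prod_erase univ (fun b => G b (Function.update (fun _ : Fin n => s₀) a t b)) (mem_univ a), Function.update_self]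
  congr 1
  exact prod_congr rfl fun b hb => by rw [Function.update_of_ne (ne_of_mem_erase hb)]

/-- **The ONE-MARKED-SLOT class of the species-graded cumulant bound with prescribed legs, spelled out** (BGM 2006 (2.13)–(2.14), (2.77)–(2.80),
Lemma 2.6; §2.9: one source-sector vertex among in-band ones on the levels track, or the one-slot telescoping of a prescribed-legs Lipschitz
comparison): for two species `s₀ ≠ t`, the part of `𝓔ᵀ_C(Σ_s V_s; n)` carried by the patterns «species `t` at exactly one slot, `s₀` at all others»
obeys, one output label pinned and the slots `j ∈ J` constrained,
`Σ_W ‖Σ_{η one-marked} kernel_r (collapse 𝓔ᵀ_{C'}(M_η))(W)‖ ≤ n!·κ^{-r}κ^{-2(n−1)}α^{n−1}eⁿ ·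
   Σ_{δ : constraint} Σ_φ w_φ Σ_a (e³κ)^{2δ_a} N_t(δ_a, |φ⁻¹ a|) · Π_{b ≠ a} (e³κ)^{2δ_b} N_{s₀}(δ_b, |φ⁻¹ b|)`.
[cite: BenfattoGiulianiMastropietro2006, (2.13)-(2.14), (2.77)-(2.80) and Lemma 2.6] -/
theorem sum_norm_kernel_oneMarked_le_graded_prescribed_of_gramBounded {κ : ℝ} (hκ : 0 < κ) (hGB : IsGramBoundedR C κ)
    (degs : Finset ℕ) (Ksp : S → (m' : ℕ) → (Fin (2 * m') → Γ) → 𝕜) {r : ℕ} (J : Finset (Fin r)) (A : Fin r → Γ → Bool)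
    (Nsp : S → ℕ → ℕ → ℝ) (hN0 : ∀ s m' F, 0 ≤ Nsp s m' F)
    (hN : ∀ (s : S) (m' : ℕ) (T : Finset (Fin r)), T ⊆ J → ∀ (ι : T → Fin (2 * m')), Function.Injective ι →
      ∀ (t : Fin (2 * m')), (∀ j, ι j ≠ t) → ∀ a : Γ,
        ∑ Y ∈ univ.filter (fun Y : Fin (2 * m') → Γ => Y t = a),
          ‖Ksp s m' Y‖ * ∏ j : T, (if A j (Y (ι j)) = true then (1 : ℝ) else 0) ≤ Nsp s m' T.card)
    {α : ℝ} (hα : 0 < α) (hrow : ∀ X, ∑ Y, ‖C X Y‖ ≤ α) (hcol : ∀ Y, ∑ X, ‖C X Y‖ ≤ α)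
    (hn : 0 < n) {s₀ t : S} (hts : t ≠ s₀) (i : Fin r) (hi : i ∉ J) (w : Γ) :
    ∑ W ∈ univ.filter (fun W : Fin r → Γ => W i = w ∧ ∀ j ∈ J, A j (W j) = true),
        ‖∑ η ∈ (Fintype.piFinset (fun _ : Fin n => (univ : Finset S) ×ˢ degs)).filter
            (fun η => (fun b => (η b).1) ∈ (univ : Finset (Fin n)).image (fun a => Function.update (fun _ : Fin n => s₀) a t)),
          kernel 𝕜 (collapse 𝕜 (Prod.snd : Fin n × Γ → Γ)
            ((ursellOf (convMoment 𝕜 (C.submatrix Prod.snd Prod.snd)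
                (kernelVertex 𝕜 (deg := fun b : Fin n => 2 * (η b).2) (fun b => even_two_mul (η b).2)
                  fun b => replicaKer 𝕜 (Ksp (η b).1 (η b).2) b)) univ : evenPart 𝕜 (Fin n × Γ)) : GrassmannAlgebra 𝕜 (Fin n × Γ))) r W‖ ≤
      (n ! : ℝ) * (κ⁻¹ ^ r * κ⁻¹ ^ (2 * (n - 1)) * (α ^ (n - 1) * Real.exp n)) *
        ∑ δ ∈ (Fintype.piFinset fun _ : Fin n => degs) with r + 2 * (n - 1) ≤ ∑ a, 2 * δ a,
          ∑ pf : J → Fin n, ((∏ j, ((2 * δ (pf j) : ℕ) : ℝ)) / ((∑ a, 2 * δ a : ℕ) : ℝ) ^ J.card) *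
            ∑ a, (Real.exp 3 * κ) ^ (2 * δ a) * Nsp t (δ a) (univ.filter fun j : J => pf j = a).card *
              ∏ b ∈ univ.erase a, (Real.exp 3 * κ) ^ (2 * δ b) * Nsp s₀ (δ b) (univ.filter fun j : J => pf j = b).card := by
  have h := sum_norm_kernel_speciesClass_le_graded_prescribed_of_gramBounded C hκ hGB degs Ksp J A Nsp hN0 hN hα hrow hcol hn
    ((univ : Finset (Fin n)).image (fun a => Function.update (fun _ : Fin n => s₀) a t)) i hi w
  refine h.trans (le_of_eq ?_)
  congr 1
  refine sum_congr rfl fun δ _ => ?_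
  -- exchange the pattern sum and the profile average, then spell out the pattern sum profile by profile
  rw [sum_comm]
  refine sum_congr rfl fun pf _ => ?_
  rw [← mul_sum]
  congr 1
  exact sum_oneMarked_eq' hts (fun b s => (Real.exp 3 * κ) ^ (2 * δ b) * Nsp s (δ b) (univ.filter fun j : J => pf j = b).card)

end Species

end Literature.MathematicalPhysics.QuantumLattice

end
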